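import Literature.NumberTheory.EllipticCurves.InertiaAboveEllCyclotomicProofs
import HarnessLib

/-!
# An inertia element above `ℓ` on which the mod-`ℓ` cyclotomic character is non-trivial
(route `SkinnerWilesDefectOne`, item stmt-Langlands-12922 `FiveIsogenyEllipticCurves`, helper)

For an imaginary quadratic field `F` and a place `v ∣ 5`, the residual cyclotomic character
`ω = χ₅ mod 5` is non-trivial on the inertia group at `v`: `e(F_v/ℚ₅) ≤ 2 < 4 = [ℚ₅(ζ₅) : ℚ₅]`.
This is the input making the `5`-isogeny data of the headline corollary automatically
`5`-distinguished.  We prove the Galois-theoretic form: for a number field `K`, a prime `ℓ`,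
`v ∣ ℓ`, `𝔓 ∣ v`, and a unit `w ∈ ℤ_ℓˣ` none of whose powers `w^j`, `1 ≤ j ≤ [K : ℚ]`, is
`≡ 1 (mod ℓ)`, some `τ ∈ I_𝔓` has `χ_ℓ(τ) ≢ 1 (mod ℓ)` (`exists_mem_inertia_cyclotomicCharacter_not_dvd`);
for `[K : ℚ] = 2` and `ℓ = 5` take `w = 2` (`2, 4 ≢ 1 mod 5`).  The proof is that of the tree's
`exists_mem_inertia_cyclotomicCharacter_ne_one` (restriction to `ℚ`, where `χ_ℓ(I) = ℤ_ℓˣ`,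
`exists_mem_inertia_cyclotomicCharacter_eq`), keeping track of the exponent bound
`j ≤ [res(Γ_K) : Γ_ℚ] = [K : ℚ]` (Mathlib `Subgroup.exists_pow_mem_of_index_ne_zero`).

References: J.-P. Serre, *Propriétés galoisiennes des points d'ordre fini des courbes
elliptiques*, Invent. Math. 15 (1972), §1.3–1.7 (the characters of tame inertia; `ω|_I` has order
`(ℓ-1)/gcd(e, ℓ-1)`); J. Neukirch, *Algebraic Number Theory* (1999), II (7.13), I (9.4).
-/

noncomputable section

-- `Summit.Langlands.Langlands.…`: summit = sub-problem name (D-0017 layout), as in every Theorems file here.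
set_option linter.dupNamespace false

open scoped NumberField
open Field IsDedekindDomain NumberField
open Literature.NumberTheory.GaloisRepresentations Literature.NumberTheory.EllipticCurves

namespace Summit.Langlands.Langlands.Theorems.FiveIsogenyEllipticCurves

universe u

variable {K : Type u} [Field K] [NumberField K]

/-- **A positive power of bounded exponent of any `g ∈ Γ_ℚ` restricts from `Γ_K`**: some `g ^ j`,
`1 ≤ j ≤ [K : ℚ]`, lies in the image of `Γ_K → Γ_ℚ` (that image is the fixing subgroup of a copy
of `K`, of index `[K : ℚ]`; `Subgroup.exists_pow_mem_of_index_ne_zero`).  The tree's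
`exists_pow_mem_range_absGaloisRestrict` without discarding the bound. [folklore] -/
theorem exists_pow_le_finrank_mem_range_absGaloisRestrict (g : absoluteGaloisGroup ℚ) :
    ∃ j : ℕ, 0 < j ∧ j ≤ Module.finrank ℚ K ∧ g ^ j ∈ (absGaloisRestrict ℚ K).range := by
  obtain ⟨e, he⟩ := exists_mem_range_absGaloisRestrict_iff ℚ K
  have hK' : (absGaloisRestrict ℚ K).range =
      (e.fieldRange.fixingSubgroup : Subgroup (absoluteGaloisGroup ℚ)) := by
    ext g
    refine (he g).trans (Iff.trans ?_ (mem_fixingSubgroup_iff_forall_smul e.fieldRange g).symm)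
    constructor
    · rintro h ⟨x, ⟨k, rfl⟩⟩
      exact h k
    · intro h k
      exact h ⟨e k, ⟨k, rfl⟩⟩
  haveI : FiniteDimensional ℚ e.fieldRange :=
    LinearEquiv.finiteDimensional e.equivFieldRange.toLinearEquiv
  have hidx' : (absGaloisRestrict ℚ K).range.index = Module.finrank ℚ K := by
    rw [hK', e.equivFieldRange.toLinearEquiv.finrank_eq]
    exact (IntermediateField.finrank_eq_fixingSubgroup_index e.fieldRange).symm
  have hidx : (absGaloisRestrict ℚ K).range.index ≠ 0 := by
    rw [hidx']
    exact Module.finrank_pos.ne'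
  obtain ⟨j, hj, hjle, hmem⟩ := Subgroup.exists_pow_mem_of_index_ne_zero hidx g
  exact ⟨j, hj, hidx' ▸ hjle, hmem⟩

/-- **An inertia element above `ℓ` with `χ_ℓ ≢ 1 (mod ℓ)`.**  Let `K` be a number field, `ℓ` a
prime, `v ∣ ℓ` a finite place, `𝔓 ∣ v` a prime of `\bar ℤ_K`, and `w ∈ ℤ_ℓˣ` a unit with
`w ^ j ≢ 1 (mod ℓ)` for `1 ≤ j ≤ [K : ℚ]`.  Then some `τ` in the inertia group `I_𝔓 ≤ Γ_K` has
`χ_ℓ(τ) ≢ 1 (mod ℓ)`, i.e. the residual cyclotomic character `ω` is ramified at `v`.  Proof: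
over `ℚ` pick `τ' ∈ I_{𝔓 ∩ \bar ℤ}` with `χ_ℓ(τ') = w` (`exists_mem_inertia_cyclotomicCharacter_eq`);
`τ'^j = res τ` for some `1 ≤ j ≤ [K:ℚ]`; `τ ∈ I_𝔓` (`comap_inertia_comap_absIntegersMap`) and
`χ_ℓ^K(τ) = w^j`. [cite: Serre1972, §1.7] -/
theorem exists_mem_inertia_cyclotomicCharacter_not_dvd (ℓ : ℕ) [hℓ : Fact ℓ.Prime]
    {v : HeightOneSpectrum (𝓞 K)} (hℓv : (ℓ : 𝓞 K) ∈ v.asIdeal)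
    {𝔓 : Ideal (absIntegers (𝓞 K) K)} (h𝔓 : 𝔓 ∈ v.primesAbove) (w : ℤ_[ℓ]ˣ)
    (hw : ∀ j : ℕ, 0 < j → j ≤ Module.finrank ℚ K → ¬ (ℓ : ℤ_[ℓ]) ∣ (w : ℤ_[ℓ]) ^ j - 1) :
    ∃ τ ∈ 𝔓.inertia (absoluteGaloisGroup K),
      ¬ (ℓ : ℤ_[ℓ]) ∣ ((GaloisRep.cyclotomicCharacter K ℓ τ : ℤ_[ℓ]ˣ) : ℤ_[ℓ]) - 1 := by
  obtain ⟨u, hu, hvu⟩ := exists_heightOneSpectrum_rat_under hℓ.out hℓv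
  have h𝔓' : 𝔓.comap (absIntegersMap ℚ K) ∈ u.primesAbove :=
    comap_absIntegersMap_mem_primesAbove hu h𝔓
  obtain ⟨τ', hτ'I, hτ'χ⟩ := exists_mem_inertia_cyclotomicCharacter_eq ℓ hvu h𝔓' w
  obtain ⟨j, hj, hjle, τ, hτ⟩ := exists_pow_le_finrank_mem_range_absGaloisRestrict (K := K) τ'
  have hτ' : absGaloisRestrict ℚ K τ = τ' ^ j := hτ
  refine ⟨τ, ?_, ?_⟩
  · rw [← comap_inertia_comap_absIntegersMap ℚ K 𝔓, Subgroup.mem_comap]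
    change absGaloisRestrict ℚ K τ ∈ _
    rw [hτ']
    exact Subgroup.pow_mem _ hτ'I j
  · rw [cyclotomicCharacter_eq_cyclotomicCharacter_rat_absGaloisRestrict K ℓ τ, hτ', map_pow, hτ'χ,
      Units.val_pow_eq_pow_val]
    exact hw j hj hjle

/-- **Over a quadratic field, `ω = χ₅ mod 5` is ramified above `5`.**  For `[K : ℚ] = 2`,
`v ∣ 5` and `𝔓 ∣ v`, some `τ ∈ I_𝔓` has `χ₅(τ) ≢ 1 (mod 5)` (take `w = 2`: `2 ≢ 1`, `4 ≢ 1 mod 5`;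
numerically `e(K_v/ℚ₅) ≤ 2 < 4`). [cite: Serre1972, §1.7] -/
theorem exists_mem_inertia_cyclotomicCharacter_five_not_dvd (hdeg : Module.finrank ℚ K = 2)
    {v : HeightOneSpectrum (𝓞 K)} (h5v : ((5 : ℕ) : 𝓞 K) ∈ v.asIdeal)
    {𝔓 : Ideal (absIntegers (𝓞 K) K)} (h𝔓 : 𝔓 ∈ v.primesAbove) :
    haveI : Fact (Nat.Prime 5) := ⟨by norm_num⟩
    ∃ τ ∈ 𝔓.inertia (absoluteGaloisGroup K),
      ¬ ((5 : ℕ) : ℤ_[5]) ∣ ((GaloisRep.cyclotomicCharacter K 5 τ : ℤ_[5]ˣ) : ℤ_[5]) - 1 := by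
  haveI : Fact (Nat.Prime 5) := ⟨by norm_num⟩
  -- `w = 2`, a unit of `ℤ_5`
  have h2 : IsUnit ((2 : ℤ) : ℤ_[5]) := by
    rw [PadicInt.isUnit_iff]
    apply le_antisymm (PadicInt.norm_le_one _)
    by_contra hlt
    rw [not_le, PadicInt.norm_int_lt_one_iff_dvd] at hlt
    norm_num at hlt
  refine exists_mem_inertia_cyclotomicCharacter_not_dvd 5 h5v h𝔓 h2.unit fun j hj hjle hdvd => ?_
  rw [hdeg] at hjle
  rw [IsUnit.unit_spec] at hdvd
  -- `(2 : ℤ_5) ^ j - 1` for `j = 1, 2` is `1` or `3`, not divisible by `5`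
  have key : ∀ m : ℤ, ((5 : ℕ) : ℤ_[5]) ∣ (m : ℤ_[5]) → (5 : ℤ) ∣ m := by
    intro m hm
    have h := (PadicInt.norm_int_lt_one_iff_dvd m).mp
      ((PadicInt.norm_lt_one_iff_dvd _).mpr (by exact_mod_cast hm))
    exact_mod_cast h
  interval_cases j
  · have : ((5 : ℕ) : ℤ_[5]) ∣ ((1 : ℤ) : ℤ_[5]) := by
      convert hdvd using 1; push_cast; ring
    have h := key 1 this
    norm_num at h
  · have : ((5 : ℕ) : ℤ_[5]) ∣ ((3 : ℤ) : ℤ_[5]) := by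
      convert hdvd using 1; push_cast; ring
    have h := key 3 this
    norm_num at h

end Summit.Langlands.Langlands.Theorems.FiveIsogenyEllipticCurves

end
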